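import Summits.HodgeConjecture.HodgeConjecture.Theorems.Ring2AbelianAllSpreadPrimitiveMiddleSix
import Summits.HodgeConjecture.HodgeConjecture.Theorems.WeilTypeLadderFloorFromLocalAnchor
import HarnessLib

/-!
# Ring 2 around `HC_CM` — AbelianAll / SPREAD axis, part XXX: part XXIX's print-modulus rows with Schoen's `6 → 4`
transfer DISCHARGED BY NAME — the first open layer `HC_AV ↔ PM⦃≥3⦄` now rests on TWO displayed facts, not three

HONEST FRAMING (page 1, verbatim in every file of this cell): research route, not a corollary; conditional on HC_CM plus
one named minimal statement. (Cell line: research route conditional on HC_CM; not a corollary; Q11.4-sentence-2 already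
refuted in dim ≥ 3.)
`HC_CM` := `Theses.RankFourFaces.CMAbelianHodge` (item stmt-HodgeConjecture-3052) is OPEN and is only ever a HYPOTHESIS
below (§3), by name. `HC_AV` := `Theses.PadicSemiregularLift.HodgeAbelianVarieties` (stmt-1333) and `CMToAbelian`
(stmt-16267) are OPEN route items, by name; nothing here decides them. NO node, NO `def`, NO new named fact, NO `sorry`:
the shapes `PM⦃≥M⦄`, `PM⦃=M⦄`, `F_CM⦃prim,mid,≥3⦄` are part XXIX's display-only `local notation3`, copied verbatim (census-
invisible by design). Part XXIX is UNTOUCHED (its bytes and import closure stand); the B_min OF RECORD of this axis is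
unchanged (`MiddleHodgeFailureSpreadsToCMFibre`, part XXIV, census N104); "minimal" / "strictly weaker" is claimed for
NOTHING in this file.

TRIGGER. Part XXIX's finest row `HC_AV_iff_primitiveMiddle_ge_three_of_moonenZarhin_of_hyperbolicSixfolds_of_schoen` displays
THREE Literature named facts: `h01 = MoonenZarhin1999_codimTwoHodgeClasses_abelianFourfold` (Math. Ann. 315 (1999) Thm. 0.1,
refereed), `h₁ = Markman2025_weilClasses_algebraic_hyperbolicSixfold` (arXiv:2502.03415 Thm. 1.5.1, PREPRINT, UNREFEREED) and
`h₃ = Schoen1998_weilClasses_algebraic_of_prod_surface` (Compositio 114 (1998) §10 Proposition, refereed). The WHOLE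
implication `h₁ → Markman2025_weilClasses_algebraic_abelianFourfold` (split sixfolds ⟹ ALL Weil-type fourfolds, every
discriminant — Markman's Cor. 1.6.1, proof, first sentence) is ALREADY A THEOREM OF THE TREE with NO named-fact hypothesis:
the hodge-weil ladder's `WeilTypeLadder.floorFourfolds_of_floorSixfolds` (`Theorems/WeilTypeLadderFloorFromLocalAnchor`,
p177717, 2026-08-18; proof = the PROVED `stub_descend 2 d` of `Theorems/PadicSemiregularLiftHodgeAbelianVarietiesStubDescendPrym`,
i.e. the partner Weil surface `exists_weilTypeSurface_prod_isHyperbolicWeilType_all_holds` + Schoen's all-`n` transfer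
`Schoen1998_weilClasses_algebraic_of_prod_surface_all_holds` (`Literature/…/WeilClassesDescendingTransfer`), both tree theorems;
standard axioms). The cell's literature table (BINDER-OWNERS TABLE v26, row c38, 2026-08-21) independently records a closed
`n = 2` inhabitant of `h₃` (habitat1's `Ring2.Habitat.schoen1998_prodSurface_transfer_sixfold_fourfold`, 2026-08-19). Neither
is named `…_holds` after `h₃`, which is why part XXIX displayed `h₃`. This file consumes the ladder's theorem BY NAME (count
once theirs; nothing re-typed, nothing re-proved) and restates part XXIX §3–§4's print-modulus rows WITHOUT `h₃`:
* §1 `HCAtDim 4`, `HCUpToDim 4` and the fourfold layer `PM⦃=2⦄` modulo `{h01, h₁}` (typer 1's rows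
  `hcAtDim_four_of_weilClassesFourfolds`, `hcUpToDim_four_iff_weilClassesFourfolds` fed with
  `WeilTypeLadder.floorFourfolds_of_floorSixfolds h₁`, all by name).
REV 2 (gate bounce p261021 `dedup.landed`, recorded honestly): rev 1's §1 row `weilClassesFourfolds_of_hyperbolicSixfolds :
h₁ → Markman2025_weilClasses_algebraic_abelianFourfold` RESTATED the landed `WeilTypeLadder.floorFourfolds_of_floorSixfolds`;
it is deleted and the landed declaration is used instead; the other rows are unchanged.
* §2 **`HC_AV ↔ PM⦃≥3⦄` modulo `{h01, h₁}`**: given Moonen–Zarhin's fourfold classification (refereed) and Markman's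
  split-SIXFOLD theorem (preprint), the Hodge conjecture for ALL complex abelian varieties is EXACTLY the algebraicity of the
  rational `(m,m)` Λ-primitive middle classes on abelian varieties of even dimension `2m ≥ 6`; `PM⦃=3⦄ → HCUpToDim 5` and the
  counterexample-locus row on the same modulus.
* §3 THE FLOOR READ on the same modulus (`HC_CM` enters here only), in the LEAD's Frame grammar: `ExactWithCM F_CM⦃prim,mid,≥3⦄`,
  `ClosesWithCM`, `(HC_CM → F_CM⦃prim,mid,≥3⦄) ↔ CMToAbelian`, `F_CM⦃prim,mid,≥3⦄ ↔ HC_AV` under `HC_CM` — the brief's shape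
  `HC_CM → B → HC_AV` with `B` = anchored spreading for primitive middle classes in even dimension `≥ 6`, modulo one refereed
  classification fact and one preprint; `B` is NOT a node (N104 ⟹ it, forget) and NOT claimed minimal.
* §4 one summary row; audit.

HONEST COLUMN. (a) Every row still DISPLAYS `h₁`, an UNREFEREED preprint claim (arXiv:2502.03415 Thm. 1.5.1; survey restatement
arXiv:2509.23403 Thm. 1.2); a refereeing failure of Thm. 1.5.1 voids nothing here (implications) but returns the first open
layer to part XXIX's fact-free form `HC_AV ↔ HCAtDim 4 ∧ PM⦃≥3⦄`. (b) `h01` is refereed but has no `_holds` in the tree. (c) No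
converse `F_CM⦃prim,mid,≥3⦄ → N104` and nothing `HC_CM`-free is added to the floor; the census is untouched (0 nodes, 0 columns).
(d) Import cost, stated: `WeilTypeLadderFloorFromLocalAnchor` adds 38 accepted `Theorems/` modules to this axis's
closure (the HeckePrym / StubDescend / WeilTypeLadder files; 0 `Literature/` modules, 0 modules under `Cruxes/`); part XXIX's
own closure is unchanged because XXIX is not edited. (e) In print the
dimension-`≤ 5` statement modulo the Weil-fourfold cell is Markman arXiv:2509.23403 Cor. 1.3 / p. 2, and "fourfold cell ⟸
split sixfolds + Schoen" is ibid. §11.5 Step 2 and arXiv:2502.03415 Cor. 1.6.1 (proof) with Koike 2004 Rem. 2.1 for Schoen's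
Proposition 10; this file adds no mathematics to those, it removes one displayed binder from the kernel rows.
Count once: `floorFourfolds_of_floorSixfolds`, `stub_descend`, the partner surface and Schoen's all-`n` transfer (hodge-weil
ladder and the HeckePrym / StubDescend files it imports), the `n = 2` Schoen inhabitant (habitat1, not imported here), rows
`g = 4` and the frame `HCAtDim`/`HCUpToDim` (typer 1), the layer calculus and floor rows (part XXIX, this seat), the Frame
grammar (LEAD).
-/

open CategoryTheory AlgebraicGeometry MonoidalCategory CartesianMonoidalCategory
open Literature.AlgebraicGeometry Literature.AlgebraicGeometry.Motives
open Literature.AlgebraicGeometry.HodgeTheory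
open Literature.AlgebraicTopology.SingularHomology
open Literature.Geometry.Kaehler (lefschetzOperator)

set_option linter.dupNamespace false

namespace Summit.HodgeConjecture.HodgeConjecture.Ring2.AbelianAll

open Summit.HodgeConjecture.HodgeConjecture
open Summit.HodgeConjecture.HodgeConjecture.Theorems
open Summit.HodgeConjecture.HodgeConjecture.Theses
open Summit.HodgeConjecture.HodgeConjecture.Theses.RankFourFaces (CMAbelianHodge CMToAbelian)
open Summit.HodgeConjecture.HodgeConjecture.Theses.PadicSemiregularLift (HodgeAbelianVarieties)
open Summit.HodgeConjecture.HodgeConjecture.Ring2.Deform (cmLocus)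
open Summit.HodgeConjecture.HodgeConjecture.WeilTypeLadder (floorFourfolds_of_floorSixfolds)
open Summit.HodgeConjecture.HodgeConjecture.Ring2.ClassTargets (HCAtDim HCUpToDim hcUpToDim_iff_hcAtDim
  hcAtDim_four_of_weilClassesFourfolds hcUpToDim_four_iff_weilClassesFourfolds hcOnClass_of_hodgeAbelianVarieties)

/-! ## §0 Part XXIX's display-only shapes (NO `def`), verbatim -/
/-- Display-only (NO `def`): the layers `m ≥ M` (and `m ≥ 2`) of part XXVIII's primitive-middle normal form. -/
local notation3 (prettyPrint := false) "PM⦃≥" M "⦄" =>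
  ∀ (A : AbelianVariety ℂ) (Λ : HardLefschetzNFold (AbelianVariety.dim A) (AbelianVariety.X A)) (m : ℕ), 2 ≤ m → M ≤ m →
    AbelianVariety.dim A = 2 * m →
      ∀ (c : complexBetti (AbelianVariety.X A) (2 * m)), IsRationalClass c →
        IsOfHodgeType (AbelianVariety.dim A) (AbelianVariety.X A) (2 * m) m m c →
          c ∈ primitiveClasses (HardLefschetzNFold.hyperplaneClass Λ) (AbelianVariety.dim A) (2 * m) →
            c ∈ algebraicClasses (AbelianVariety.X A) m

/-- Display-only (NO `def`): the single layer `m = M`. -/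
local notation3 (prettyPrint := false) "PM⦃=" M "⦄" =>
  ∀ (A : AbelianVariety ℂ) (Λ : HardLefschetzNFold (AbelianVariety.dim A) (AbelianVariety.X A)),
    AbelianVariety.dim A = 2 * M →
      ∀ (c : complexBetti (AbelianVariety.X A) (2 * M)), IsRationalClass c →
        IsOfHodgeType (AbelianVariety.dim A) (AbelianVariety.X A) (2 * M) M M c →
          c ∈ primitiveClasses (HardLefschetzNFold.hyperplaneClass Λ) (AbelianVariety.dim A) (2 * M) →
            c ∈ algebraicClasses (AbelianVariety.X A) M

/-- Display-only shape (NO `def`; census-invisible by design): part XXIX §4's `F_CM⦃prim,mid,≥3⦄`, verbatim. -/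
local notation3 (prettyPrint := false) "F_CM⦃prim,mid,≥3⦄" =>
  ∀ (A : AbelianVariety ℂ), IsSmoothProjective (AbelianVariety.dim A) (AbelianVariety.X A) →
    ∀ (Λ : HardLefschetzNFold (AbelianVariety.dim A) (AbelianVariety.X A)) (m : ℕ), 3 ≤ m →
      AbelianVariety.dim A = 2 * m →
        ∀ (c : complexBetti (AbelianVariety.X A) (2 * m)), IsRationalClass c →
          IsOfHodgeType (AbelianVariety.dim A) (AbelianVariety.X A) (2 * m) m m c →
            c ∈ primitiveClasses (HardLefschetzNFold.hyperplaneClass Λ) (AbelianVariety.dim A) (2 * m) →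
              c ∉ algebraicClasses (AbelianVariety.X A) m →
                ∃ (n : ℕ) (𝒳 S : SchemeOver ℂ) (f : 𝒳 ⟶ S) (s : ComplexPoints S) (W : complexBetti 𝒳 (2 * m)),
                  IsCMAnchoredDatumFor A m c f n s W ∧
                    ∃ s' ∈ cmLocus f n,
                      complexBetti.map (fiberι f s') (2 * m) W ∉ algebraicClasses (fiberOver f s') m

/-! ## §1 Rows `g ≤ 4` modulo `{h01, h₁}` — the Weil-fourfold cell from split sixfolds is the TREE THEOREM
`WeilTypeLadder.floorFourfolds_of_floorSixfolds` (hodge-weil ladder, p177717), consumed by name -/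

/-- **Row `g = 4` modulo `{h01, h₁}`**: Moonen–Zarhin's fourfold classification (refereed, displayed) and Markman's split sixfolds
(preprint, displayed) give the Hodge conjecture for every complex abelian FOURFOLD: typer 1's `hcAtDim_four_of_weilClassesFourfolds`
fed with the hodge-weil ladder's UNCONDITIONAL `WeilTypeLadder.floorFourfolds_of_floorSixfolds h₁` (split sixfolds ⟹ all Weil-type
fourfolds: partner surface + Schoen's transfer, both tree theorems), all by name. [cite: Schoen1998HodgeWeilAddendum, §10
(Proposition, pp. 332–333)] [cite: Koike2004WeilHodge, Remark 2.1] [cite: MoonenZarhin1999LowDim, Thm. 0.1 with (1.4), (1.9); arXiv:math/9901113] [cite: Markman2025SecantWeil, Thm. 1.5.1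
and Cor. 1.6.1] -/
theorem hcAtDim_four_of_moonenZarhin_of_hyperbolicSixfolds (h01 : MoonenZarhin1999_codimTwoHodgeClasses_abelianFourfold)
    (h₁ : Markman2025_weilClasses_algebraic_hyperbolicSixfold) : HCAtDim 4 :=
  hcAtDim_four_of_weilClassesFourfolds h01 (floorFourfolds_of_floorSixfolds h₁)

/-- Rows `g ≤ 4` modulo `{h01, h₁}`. [cite: MoonenZarhin1999LowDim, Thm. 0.1; arXiv:math/9901113] [cite: Markman2025SecantWeil,
Cor. 1.6.1] -/
theorem hcUpToDim_four_of_moonenZarhin_of_hyperbolicSixfolds (h01 : MoonenZarhin1999_codimTwoHodgeClasses_abelianFourfold)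
    (h₁ : Markman2025_weilClasses_algebraic_hyperbolicSixfold) : HCUpToDim 4 :=
  (hcUpToDim_four_iff_weilClassesFourfolds h01).2 (floorFourfolds_of_floorSixfolds h₁)

/-- The fourfold LAYER `PM⦃=2⦄` of the primitive-middle normal form modulo `{h01, h₁}` (part XXIX
`hcAtDim_four_iff_primitiveMiddle_two`). [cite: MoonenZarhin1999LowDim, Thm. 0.1] [cite: Markman2025SecantWeil, Cor. 1.6.1]
[cite: VoisinHodgeI2002, Cor. 6.26 and Rem. 6.27] -/
theorem primitiveMiddle_two_of_moonenZarhin_of_hyperbolicSixfolds (h01 : MoonenZarhin1999_codimTwoHodgeClasses_abelianFourfold)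
    (h₁ : Markman2025_weilClasses_algebraic_hyperbolicSixfold) : PM⦃=2⦄ :=
  hcAtDim_four_iff_primitiveMiddle_two.1 (hcAtDim_four_of_moonenZarhin_of_hyperbolicSixfolds h01 h₁)

/-! ## §2 The first open layer modulo `{h01, h₁}`: part XXIX §3 without `h₃` -/

/-- **HEADLINE, MOD `{h01, h₁}` (both displayed; `h₁` UNREFEREED): `HC_AV ↔ PM⦃≥3⦄`** — given Moonen–Zarhin's fourfold
classification and Markman's split-sixfold theorem, the Hodge conjecture for ALL complex abelian varieties is exactly the
algebraicity of the rational `(m,m)` Λ-primitive MIDDLE classes on abelian varieties of even dimension `2m ≥ 6`. This is part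
XXIX's `…_of_hyperbolicSixfolds_of_schoen` with Schoen's transfer fed by name (`h₃` dropped).
[cite: MoonenZarhin1999LowDim, Thm. 0.1; arXiv:math/9901113] [cite: Markman2025SecantWeil, Thm. 1.5.1 and Cor. 1.6.1]
[cite: Schoen1998HodgeWeilAddendum, §10] [cite: VoisinHodgeI2002, Cor. 6.26 and Rem. 6.27] -/
theorem HC_AV_iff_primitiveMiddle_ge_three_of_moonenZarhin_of_hyperbolicSixfolds
    (h01 : MoonenZarhin1999_codimTwoHodgeClasses_abelianFourfold) (h₁ : Markman2025_weilClasses_algebraic_hyperbolicSixfold) :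
    HodgeAbelianVarieties ↔ PM⦃≥3⦄ :=
  HC_AV_iff_primitiveMiddle_ge_three_of_hcAtDim_four (hcAtDim_four_of_moonenZarhin_of_hyperbolicSixfolds h01 h₁)

/-- Consistency (kernel): part XXIX's three-binder row, at ANY `h₃`, IS the two-binder row (proof irrelevance) — dropping the
Schoen binder changes no statement. [folklore] -/
example (h01 : MoonenZarhin1999_codimTwoHodgeClasses_abelianFourfold) (h₁ : Markman2025_weilClasses_algebraic_hyperbolicSixfold)
    (h₃ : Schoen1998_weilClasses_algebraic_of_prod_surface) :
    HC_AV_iff_primitiveMiddle_ge_three_of_moonenZarhin_of_hyperbolicSixfolds_of_schoen h01 h₁ h₃ =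
      HC_AV_iff_primitiveMiddle_ge_three_of_moonenZarhin_of_hyperbolicSixfolds h01 h₁ :=
  rfl

/-- MOD `{h01, h₁}`: **the SIXFOLD layer alone gives every abelian variety of dimension `≤ 5`** — `PM⦃=3⦄ → HCUpToDim 5`, with
Moonen–Zarhin's fivefold Thm. 0.2 NOT among the inputs. [cite: MoonenZarhin1999LowDim, Thms. 0.1, 0.2 (contrast)]
[cite: Markman2025SecantWeil, Cor. 1.6.1] [cite: Markman2025SurveySecant, Cor. 1.3] [cite: BrosnanFangNiePearlstein2009, §6 Lemma 48] -/
theorem hcUpToDim_five_of_primitiveMiddle_three_of_moonenZarhin_of_hyperbolicSixfolds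
    (h01 : MoonenZarhin1999_codimTwoHodgeClasses_abelianFourfold) (h₁ : Markman2025_weilClasses_algebraic_hyperbolicSixfold)
    (h6 : PM⦃=3⦄) : HCUpToDim 5 :=
  hcUpToDim_five_of_hcAtDim_four_of_primitiveMiddle_three (hcAtDim_four_of_moonenZarhin_of_hyperbolicSixfolds h01 h₁) h6

/-- MOD `{h01, h₁}`: **a counterexample to `HC_AV`, if any, is a rational `(m,m)` Λ-primitive middle class on an abelian
variety of EVEN dimension `2m ≥ 6`.** [cite: MoonenZarhin1999LowDim, Thm. 0.1] [cite: Markman2025SecantWeil, Cor. 1.6.1]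
[cite: VoisinHodgeI2002, Cor. 6.26 and Rem. 6.27] -/
theorem not_HC_AV_iff_exists_primitiveMiddle_ge_three_not_mem_of_moonenZarhin_of_hyperbolicSixfolds
    (h01 : MoonenZarhin1999_codimTwoHodgeClasses_abelianFourfold) (h₁ : Markman2025_weilClasses_algebraic_hyperbolicSixfold) :
    ¬ HodgeAbelianVarieties ↔
      ∃ (A : AbelianVariety ℂ) (Λ : HardLefschetzNFold A.dim A.X) (m : ℕ), 3 ≤ m ∧ A.dim = 2 * m ∧
        ∃ c : complexBetti A.X (2 * m), IsRationalClass c ∧ IsOfHodgeType A.dim A.X (2 * m) m m c ∧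
          c ∈ primitiveClasses Λ.hyperplaneClass A.dim (2 * m) ∧ c ∉ algebraicClasses A.X m :=
  not_HC_AV_iff_exists_primitiveMiddle_ge_three_not_mem_of_hcAtDim_four
    (hcAtDim_four_of_moonenZarhin_of_hyperbolicSixfolds h01 h₁)

/-! ## §3 The anchored floor read on the first open layer, modulo `{h01, h₁}` (`HC_CM` enters here only; NO node) -/

/-- **EXACTNESS MOD `{h01, h₁}`, in the Frame grammar: `ExactWithCM F_CM⦃prim,mid,≥3⦄`**, i.e.
`HC_AV ↔ HC_CM ∧ F_CM⦃prim,mid,≥3⦄` — part XXIX's fact-free `HC_AV ↔ HCAtDim 4 ∧ (HC_CM ∧ F_CM⦃prim,mid,≥3⦄)` with the row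
`g = 4` supplied by §1. `F_CM⦃prim,mid,≥3⦄` is display-only, implied by the B_min of record N104, and NOT claimed minimal.
[cite: Deligne1982HodgeCycles, §6 proof of Thm. 2.11 (pp. 71–73)] [cite: MoonenZarhin1999LowDim, Thm. 0.1]
[cite: Markman2025SecantWeil, Cor. 1.6.1] -/
theorem exactWithCM_primitiveMiddleSpreadingGeThree_of_moonenZarhin_of_hyperbolicSixfolds
    (h01 : MoonenZarhin1999_codimTwoHodgeClasses_abelianFourfold) (h₁ : Markman2025_weilClasses_algebraic_hyperbolicSixfold) :
    ExactWithCM (F_CM⦃prim,mid,≥3⦄) :=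
  HC_AV_iff_hcAtDim_four_and_HC_CM_and_primitiveMiddleSpreadingGeThree.trans
    ⟨fun h ↦ h.2, fun h ↦ ⟨hcAtDim_four_of_moonenZarhin_of_hyperbolicSixfolds h01 h₁, h⟩⟩

/-- **CLOSING MOD `{h01, h₁}`: `HC_CM → F_CM⦃prim,mid,≥3⦄ → HC_AV`** — the brief's shape `HC_CM → B → HC_AV` with `B` = anchored
spreading for Λ-primitive middle classes in even dimension `≥ 6`, modulo one refereed classification fact and one preprint.
[cite: Deligne1982HodgeCycles, §6 proof of Thm. 2.11 (pp. 71–73)] [cite: Milne1999, §7 p. 72 (hypothesis (H))]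
[cite: MoonenZarhin1999LowDim, Thm. 0.1] [cite: Markman2025SecantWeil, Cor. 1.6.1] -/
theorem closesWithCM_primitiveMiddleSpreadingGeThree_of_moonenZarhin_of_hyperbolicSixfolds
    (h01 : MoonenZarhin1999_codimTwoHodgeClasses_abelianFourfold) (h₁ : Markman2025_weilClasses_algebraic_hyperbolicSixfold) :
    ClosesWithCM (F_CM⦃prim,mid,≥3⦄) :=
  fun hCM h ↦ HC_AV_of_HC_CM_of_hcAtDim_four_of_primitiveMiddleSpreadingGeThree hCM
    (hcAtDim_four_of_moonenZarhin_of_hyperbolicSixfolds h01 h₁) h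

/-- The same as a plain implication: `HC_CM → F_CM⦃prim,mid,≥3⦄ → HC_AV` modulo `{h01, h₁}`. [folklore] -/
theorem HC_AV_of_HC_CM_of_primitiveMiddleSpreadingGeThree_of_moonenZarhin_of_hyperbolicSixfolds
    (h01 : MoonenZarhin1999_codimTwoHodgeClasses_abelianFourfold) (h₁ : Markman2025_weilClasses_algebraic_hyperbolicSixfold)
    (hCM : CMAbelianHodge) (h : F_CM⦃prim,mid,≥3⦄) : HodgeAbelianVarieties :=
  closesWithCM_primitiveMiddleSpreadingGeThree_of_moonenZarhin_of_hyperbolicSixfolds h01 h₁ hCM h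

/-- MOD `{h01, h₁}`: `F_CM⦃prim,mid,≥3⦄ → CMToAbelian` outright (a typed conditional TOWARD stmt-HodgeConjecture-16267, which stays
OPEN). [folklore] -/
theorem cmToAbelian_of_primitiveMiddleSpreadingGeThree_of_moonenZarhin_of_hyperbolicSixfolds
    (h01 : MoonenZarhin1999_codimTwoHodgeClasses_abelianFourfold) (h₁ : Markman2025_weilClasses_algebraic_hyperbolicSixfold)
    (h : F_CM⦃prim,mid,≥3⦄) : CMToAbelian :=
  cmToAbelian_of_hcAtDim_four_of_primitiveMiddleSpreadingGeThree (hcAtDim_four_of_moonenZarhin_of_hyperbolicSixfolds h01 h₁) h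

/-- MOD `{h01, h₁}`: **relativised to `HC_CM`, `F_CM⦃prim,mid,≥3⦄` IS the item** — `(HC_CM → F_CM⦃prim,mid,≥3⦄) ↔ CMToAbelian`
(Frame `modCM_iff_cmToAbelian_of_exactWithCM`). [folklore] -/
theorem modCM_primitiveMiddleSpreadingGeThree_iff_cmToAbelian_of_moonenZarhin_of_hyperbolicSixfolds
    (h01 : MoonenZarhin1999_codimTwoHodgeClasses_abelianFourfold) (h₁ : Markman2025_weilClasses_algebraic_hyperbolicSixfold) :
    ModCM (F_CM⦃prim,mid,≥3⦄) ↔ CMToAbelian :=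
  modCM_iff_cmToAbelian_of_exactWithCM (exactWithCM_primitiveMiddleSpreadingGeThree_of_moonenZarhin_of_hyperbolicSixfolds h01 h₁)

/-- MOD `{h01, h₁}` and UNDER `HC_CM`: `F_CM⦃prim,mid,≥3⦄ ↔ HC_AV` (Frame `iff_HC_AV_of_exactWithCM_of_HC_CM`). [folklore] -/
theorem primitiveMiddleSpreadingGeThree_iff_HC_AV_of_HC_CM_of_moonenZarhin_of_hyperbolicSixfolds
    (h01 : MoonenZarhin1999_codimTwoHodgeClasses_abelianFourfold) (h₁ : Markman2025_weilClasses_algebraic_hyperbolicSixfold)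
    (hCM : CMAbelianHodge) : F_CM⦃prim,mid,≥3⦄ ↔ HodgeAbelianVarieties :=
  iff_HC_AV_of_exactWithCM_of_HC_CM
    (exactWithCM_primitiveMiddleSpreadingGeThree_of_moonenZarhin_of_hyperbolicSixfolds h01 h₁) hCM

/-! ## §4 Summary row modulo `{h01, h₁}` -/
/-- **THE FIRST OPEN LAYER ON TWO DISPLAYED FACTS, IN ONE ROW**: `HCAtDim 4`, `HC_AV ↔ PM⦃≥3⦄`, `PM⦃=3⦄ → HCUpToDim 5`,
`HC_AV ↔ HC_CM ∧ F_CM⦃prim,mid,≥3⦄`; nothing here is "minimal". [cite: MoonenZarhin1999LowDim, Thm. 0.1]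
[cite: Markman2025SecantWeil, Thm. 1.5.1 and Cor. 1.6.1] [cite: Schoen1998HodgeWeilAddendum, §10] -/
theorem spreadFloor_firstOpenLayer_reading_of_moonenZarhin_of_hyperbolicSixfolds
    (h01 : MoonenZarhin1999_codimTwoHodgeClasses_abelianFourfold) (h₁ : Markman2025_weilClasses_algebraic_hyperbolicSixfold) :
    HCAtDim 4 ∧ (HodgeAbelianVarieties ↔ PM⦃≥3⦄) ∧ (PM⦃=3⦄ → HCUpToDim 5) ∧
      (HodgeAbelianVarieties ↔ CMAbelianHodge ∧ F_CM⦃prim,mid,≥3⦄) :=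
  ⟨hcAtDim_four_of_moonenZarhin_of_hyperbolicSixfolds h01 h₁,
    HC_AV_iff_primitiveMiddle_ge_three_of_moonenZarhin_of_hyperbolicSixfolds h01 h₁,
    hcUpToDim_five_of_primitiveMiddle_three_of_moonenZarhin_of_hyperbolicSixfolds h01 h₁,
    exactWithCM_primitiveMiddleSpreadingGeThree_of_moonenZarhin_of_hyperbolicSixfolds h01 h₁⟩

/-! ## Audit (kernel-checked): closures are EXACTLY the three standard axioms; `h01`, `h₁`, `HC_CM` are binders, `h₃` is GONE -/

/-- info: 'Summit.HodgeConjecture.HodgeConjecture.Ring2.AbelianAll.hcAtDim_four_of_moonenZarhin_of_hyperbolicSixfolds' depends on axioms: [propext, Classical.choice, Quot.sound] -/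
#guard_msgs (whitespace := lax) in
#print axioms hcAtDim_four_of_moonenZarhin_of_hyperbolicSixfolds
/-- info: 'Summit.HodgeConjecture.HodgeConjecture.Ring2.AbelianAll.HC_AV_iff_primitiveMiddle_ge_three_of_moonenZarhin_of_hyperbolicSixfolds' depends on axioms: [propext, Classical.choice, Quot.sound] -/
#guard_msgs (whitespace := lax) in
#print axioms HC_AV_iff_primitiveMiddle_ge_three_of_moonenZarhin_of_hyperbolicSixfolds
/-- info: 'Summit.HodgeConjecture.HodgeConjecture.Ring2.AbelianAll.exactWithCM_primitiveMiddleSpreadingGeThree_of_moonenZarhin_of_hyperbolicSixfolds' depends on axioms: [propext, Classical.choice, Quot.sound] -/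
#guard_msgs (whitespace := lax) in
#print axioms exactWithCM_primitiveMiddleSpreadingGeThree_of_moonenZarhin_of_hyperbolicSixfolds

end Summit.HodgeConjecture.HodgeConjecture.Ring2.AbelianAll
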